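import Mathlib
import Summits.Ventures.HodgeRepro2.T5DeltaTwistTensor

/-!
# T5DeltaTwistBilinForm — the trace form of the tensor datum as a symplectic `F`-bilinear form
(Tier-5 N2 / §G support)

Continuation of this seat's `T5DeltaTwistTensor` (file 90) behind §N2.9.2 of route/T5-N2-route-3.md
(l. 63: «the symplectic space tr_{E/F}(δ⁻¹⟨·,·⟩ ⊗ δ(·,·)) = tr_{E/F}(⟨·,·⟩ ⊗ (·,·)) is the datum's»):
the form is packaged in Mathlib's vocabulary.  `F ⊆ E` through `Algebra F E`; `star` fixes the image
of `F` (`hF`); `tr_{E/F}` is Mathlib's field trace `Algebra.trace F E : E →ₗ[F] F`, and the hypothesis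
`htr` says it is `z ↦ z + star z` (true for a separable quadratic `E/F` with `star` the non-trivial
automorphism — it stays a hypothesis here, so the file applies to ANY such pair).

* `gramBilin hF K : (ι × κ → E) →ₗ[F] (ι × κ → E) →ₗ[F] E` — file 90's `gram K` is `F`-bilinear
  (with values in `E`), and `traceBilin hF K : LinearMap.BilinForm F (ι × κ → E)` is its composite
  with the field trace — the `F`-valued form `tr_{E/F}(h ⊗ s)` on `Res_{E/F}(V ⊗_E W)`;
* `algebraMap_traceBilin` (under `htr`) — it is file 90's `traceGram K` read in `E`;
* `traceBilin_twist` — the twisted and the untwisted data give the SAME `F`-bilinear form;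
* `isAlt_traceBilin` — alternating (`LinearMap.BilinForm.IsAlt`) for `M` hermitian, `N` skew-hermitian;
* `separatingLeft_traceBilin` / `nondegenerate_traceBilin` — non-degenerate
  (`LinearMap.BilinForm.Nondegenerate`) for an invertible Gram matrix and `2 ≠ 0`;
  `isAlt_and_nondegenerate_traceBilin` is the symplectic statement;
* `finrank_tensorSpace` — the `F`-dimension `|ι| · |κ| · [E : F]` (`3 · 2 · 2 = 12` for the datum).

What stays prose: that the datum's `W₁₂,v`, `V_v` are these Gram matrices over the completion `E_v`
(p4's column), that `Algebra.trace F E = z + star z` for the quadratic `E_v / F_v` (`htr`), and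
Kudla's splitting itself.
-/

namespace Summit.Ventures.HodgeRepro2.T5DeltaTwistBilinForm

open Summit.Ventures.HodgeRepro2.T5DeltaTwistTensor
open scoped Matrix Kronecker

variable {F E : Type*} [Field F] [Field E] [StarRing E] [Algebra F E]
variable {ι κ : Type*} [Fintype ι] [Fintype κ]

/-- **The Gram form as an `F`-bilinear map** `(ι × κ → E) →ₗ[F] (ι × κ → E) →ₗ[F] E` (values in `E`),
for `star` fixing the image of `F` (`hF`): file 90's `gram K` restricted to `F`-scalars. -/
def gramBilin (hF : ∀ c : F, star (algebraMap F E c) = algebraMap F E c)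
    (K : Matrix (ι × κ) (ι × κ) E) : (ι × κ → E) →ₗ[F] (ι × κ → E) →ₗ[F] E :=
  LinearMap.mk₂ F (gram K) (gram_add_left K)
    (fun c z z' => by
      rw [← algebraMap_smul E c z, gram_smul_left, hF c, Algebra.smul_def])
    (gram_add_right K)
    (fun c z z' => by
      rw [← algebraMap_smul E c z', gram_smul_right, Algebra.smul_def])

/-- Unfolding lemma: `gramBilin hF K z z' = gram K z z'`. -/
theorem gramBilin_apply (hF : ∀ c : F, star (algebraMap F E c) = algebraMap F E c)
    (K : Matrix (ι × κ) (ι × κ) E) (z z' : ι × κ → E) : gramBilin hF K z z' = gram K z z' :=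
  rfl

/-- **The trace form as an `F`-bilinear form** on the `F`-module `ι × κ → E` (the restriction of
scalars `Res_{E/F}(V ⊗_E W)`): the field trace `Algebra.trace F E` of the Gram form. -/
noncomputable def traceBilin (hF : ∀ c : F, star (algebraMap F E c) = algebraMap F E c)
    (K : Matrix (ι × κ) (ι × κ) E) : LinearMap.BilinForm F (ι × κ → E) :=
  (gramBilin hF K).compr₂ (Algebra.trace F E)

/-- Unfolding lemma: `traceBilin hF K z z' = Algebra.trace F E (gram K z z')`. -/
theorem traceBilin_apply (hF : ∀ c : F, star (algebraMap F E c) = algebraMap F E c)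
    (K : Matrix (ι × κ) (ι × κ) E) (z z' : ι × κ → E) :
    traceBilin hF K z z' = Algebra.trace F E (gram K z z') :=
  rfl

/-- Under `htr` (the field trace is `z ↦ z + star z`), `traceBilin` read in `E` is file 90's
`traceGram`. -/
theorem algebraMap_traceBilin (hF : ∀ c : F, star (algebraMap F E c) = algebraMap F E c)
    (htr : ∀ x : E, algebraMap F E (Algebra.trace F E x) = x + star x)
    (K : Matrix (ι × κ) (ι × κ) E) (z z' : ι × κ → E) :
    algebraMap F E (traceBilin hF K z z') = traceGram K z z' := by
  rw [traceBilin_apply, htr, traceGram_apply]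

/-- **The δ-twist identity as an equality of `F`-bilinear forms**:
`traceBilin hF ((δ⁻¹ • M) ⊗ₖ (δ • N)) = traceBilin hF (M ⊗ₖ N)` (and likewise for `gramBilin`). -/
theorem traceBilin_twist (hF : ∀ c : F, star (algebraMap F E c) = algebraMap F E c) (δ : E)
    (hδ : δ ≠ 0) (M : Matrix ι ι E) (N : Matrix κ κ E) :
    traceBilin hF ((δ⁻¹ • M) ⊗ₖ (δ • N)) = traceBilin hF (M ⊗ₖ N) := by
  rw [kronecker_twist δ hδ]

/-- The same for the `E`-valued Gram form. -/
theorem gramBilin_twist (hF : ∀ c : F, star (algebraMap F E c) = algebraMap F E c) (δ : E)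
    (hδ : δ ≠ 0) (M : Matrix ι ι E) (N : Matrix κ κ E) :
    gramBilin hF ((δ⁻¹ • M) ⊗ₖ (δ • N)) = gramBilin hF (M ⊗ₖ N) := by
  rw [kronecker_twist δ hδ]

/-- **Alternating**: for `M` hermitian and `N` skew-hermitian the trace form is alternating
(`LinearMap.BilinForm.IsAlt`), from file 90's `traceGram_self` through `htr` and the injectivity
of `algebraMap F E`. -/
theorem isAlt_traceBilin (hF : ∀ c : F, star (algebraMap F E c) = algebraMap F E c)
    (htr : ∀ x : E, algebraMap F E (Algebra.trace F E x) = x + star x)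
    {M : Matrix ι ι E} {N : Matrix κ κ E} (hM : Mᴴ = M) (hN : Nᴴ = -N) :
    (traceBilin hF (M ⊗ₖ N)).IsAlt := by
  intro z
  apply (algebraMap F E).injective
  rw [map_zero, algebraMap_traceBilin hF htr]
  exact traceGram_self hM hN z

/-- **Separating on the left** (`LinearMap.SeparatingLeft`) for an invertible Gram matrix `K` and
`2 ≠ 0` in `E`, from file 90's `eq_zero_of_traceGram_eq_zero`. -/
theorem separatingLeft_traceBilin [DecidableEq ι] [DecidableEq κ]
    (hF : ∀ c : F, star (algebraMap F E c) = algebraMap F E c)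
    (htr : ∀ x : E, algebraMap F E (Algebra.trace F E x) = x + star x)
    {K : Matrix (ι × κ) (ι × κ) E} (hK : IsUnit K) (h2 : (2 : E) ≠ 0) :
    (traceBilin hF K).SeparatingLeft := by
  intro z hz
  apply eq_zero_of_traceGram_eq_zero hK h2
  intro z'
  rw [← algebraMap_traceBilin hF htr, hz z', map_zero]

/-- **Non-degenerate** (`LinearMap.BilinForm.Nondegenerate` = separating on both sides): for `M`
hermitian, `N` skew-hermitian, `M ⊗ₖ N` invertible and `2 ≠ 0`, by reflexivity of an alternating form
(`LinearMap.IsRefl.nondegenerate_iff_separatingLeft`). -/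
theorem nondegenerate_traceBilin [DecidableEq ι] [DecidableEq κ]
    (hF : ∀ c : F, star (algebraMap F E c) = algebraMap F E c)
    (htr : ∀ x : E, algebraMap F E (Algebra.trace F E x) = x + star x)
    {M : Matrix ι ι E} {N : Matrix κ κ E} (hM : Mᴴ = M) (hN : Nᴴ = -N) (hK : IsUnit (M ⊗ₖ N))
    (h2 : (2 : E) ≠ 0) : (traceBilin hF (M ⊗ₖ N)).Nondegenerate := by
  show LinearMap.Nondegenerate _
  rw [LinearMap.IsRefl.nondegenerate_iff_separatingLeft (isAlt_traceBilin hF htr hM hN).isRefl]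
  exact separatingLeft_traceBilin hF htr hK h2

/-- **The symplectic statement**: for `M` hermitian invertible and `N` skew-hermitian invertible,
`2 ≠ 0`, the trace form of `M ⊗ₖ N` is alternating and non-degenerate — the symplectic
`F`-space `Res_{E/F}(V ⊗_E W, tr_{E/F}(h ⊗ s))`; by `traceBilin_twist` it is the same form for the
`δ`-twisted datum. -/
theorem isAlt_and_nondegenerate_traceBilin [DecidableEq ι] [DecidableEq κ]
    (hF : ∀ c : F, star (algebraMap F E c) = algebraMap F E c)
    (htr : ∀ x : E, algebraMap F E (Algebra.trace F E x) = x + star x) {M : Matrix ι ι E}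
    {N : Matrix κ κ E} (hM : Mᴴ = M) (hN : Nᴴ = -N) (hMu : IsUnit M.det) (hNu : IsUnit N.det)
    (h2 : (2 : E) ≠ 0) :
    (traceBilin hF (M ⊗ₖ N)).IsAlt ∧ (traceBilin hF (M ⊗ₖ N)).Nondegenerate :=
  ⟨isAlt_traceBilin hF htr hM hN, nondegenerate_traceBilin hF htr hM hN (isUnit_kronecker hMu hNu) h2⟩

omit [StarRing E] in
/-- The `F`-dimension of the tensor space: `|ι| · |κ| · [E : F]` (`12` for the datum: a hermitian
3-space, a skew-hermitian plane, `[E_v : F_v] = 2`). -/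
theorem finrank_tensorSpace [Module.Finite F E] :
    Module.finrank F (ι × κ → E) = Fintype.card ι * Fintype.card κ * Module.finrank F E := by
  rw [Module.finrank_pi_fintype, Finset.sum_const, Finset.card_univ, Fintype.card_prod, smul_eq_mul]

end Summit.Ventures.HodgeRepro2.T5DeltaTwistBilinForm
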